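import Literature.Analysis.FunctionSpaces.TimeDoubling
import HarnessLib

/-!
# Doubling of the time variable against a compactly supported cut-off (no boundary terms)

Analysis/FunctionSpaces theorem file (no definitions). A variant of the accepted abstract
doubling identity `Literature.Analysis.FunctionSpaces.doubling_identity` (Serrin 1963, §4) in
which the doubled kernel is `ρ(s - σ) χ(s)` with a `C¹` cut-off `χ` compactly supported in the
open time interval `(0, T)`: then no boundary (half-kernel) terms appear, no continuity of the
paired quantity `Q` at `s = t` or `s = 0` is needed, and the one-sided absolutely continuous
representations of `Q` are only required for almost every value of BOTH variables — which is the
form in which they come for local Leray solutions of the Navier–Stokes equations, where the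
pairing `Q(s, σ) = ∫ ψ ⟪u₁(s), u₂(σ)⟫` is only defined for a.e. `s` and a.e. `σ`
(Lemarié-Rieusset 2016, proof of Thm. 14.7, p. 515: the balance equation for `u₁ · u₂` holds in
the sense of distributions in time).

**Main result** (`doubling_identity_compact`). Let `T, δ > 0`, `Q, f, g` with
`(σ, s) ↦ Q(s, σ)`, `(σ, s) ↦ f(σ, s)`, `(σ, s) ↦ g(s, σ)` integrable on `(0,T)²`, and suppose
* for a.e. `σ`: `f(σ, ·) ∈ L¹(0,T)` and `Q(s, σ) = c(σ) + ∫_{(0,s]} f(σ, τ) dτ` for a.e. `s`;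
* for a.e. `s`: `g(s, ·) ∈ L¹(0,T)` and `Q(s, σ) = c'(s) + ∫_{(0,σ]} g(s, τ) dτ` for a.e. `σ`.
Then for every `χ ∈ C¹` with `tsupport χ ⊆ [δ, T - δ]` and every even bump kernel `ρ` with
`rOut < δ`,
`∫∫ ρ(s-σ) χ'(s) Q(s,σ) dσ ds = -∫∫ ρ(s-σ) χ(s) (f(σ,s) + g(s,σ)) dσ ds` over `(0,T)²`.

**Proof.** Compute `I = ∫∫ ∂ₛ[ρ(s-σ)χ(s)] Q(s,σ)` twice by Fubini. In `s` first: for a.e. `σ`,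
integration by parts against the primitive (`setIntegral_deriv_mul_const_add_setIntegral`, the
kernel `s ↦ ρ(s-σ)χ(s)` vanishes at `0` and `T`) gives `-∫ ρχ f`. In `σ` first:
`∂ₛ[ρ(s-σ)χ(s)] = ρ'(s-σ)χ(s) + ρ(s-σ)χ'(s)` and `ρ'(s-σ) = ∂_σ[-ρ(s-σ)]`; for `s ∈ supp χ` the
kernel `σ ↦ ρ(s-σ)` vanishes at `σ = 0, T` (`rOut < δ`), so by parts `∫ ρ' χ Q dσ = χ ∫ ρ g dσ`,
while for `s ∉ supp χ` both sides vanish. Comparing the two evaluations gives the claim.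

## Mathlib / tree search

Tree: `doubling_identity` (`TimeDoubling`, with boundary terms and everywhere-in-`s`
representations), `setIntegral_deriv_mul_const_add_setIntegral`, `exists_abs_deriv_normed_le`,
`exists_normed_le`, `normed_eq_zero_of_rOut_le_abs` (`TimeMollification`). Mathlib: `integral_prod`,
`integral_prod_symm`, `Integrable.bdd_mul`. No compact-cut-off variant exists in the tree
(searched `doubling`, `normed volume (p.2 - p.1)`).

## References

* J. Serrin, *The initial value problem for the Navier–Stokes equations*, in: Nonlinear Problems
  (Madison 1962), Univ. Wisconsin Press 1963, §4. [Serrin1963]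
* P. G. Lemarié-Rieusset, *The Navier–Stokes Problem in the 21st Century*, CRC Press 2016,
  doi:10.1201/b19556, proof of Thm. 14.7, p. 515. [LemarieRieusset2016]
-/

noncomputable section

open MeasureTheory TopologicalSpace Set Function Filter Topology Metric
open scoped ENNReal NNReal Convolution

namespace Literature.Analysis.FunctionSpaces

/-- **Doubling of the time variable against a compactly supported cut-off.** See the module
docstring; `p = (σ, s)` is the variable on `(0,T)²`, the kernel is `ρ(p.2 - p.1)`, `f σ s` is the
`s`-density of `s ↦ Q s σ` (valid for a.e. `σ`, a.e. in `s`) and `g s σ` the `σ`-density of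
`σ ↦ Q s σ` (valid for a.e. `s`, a.e. in `σ`); no boundary terms and no continuity of `Q` are
involved (Serrin 1963, §4; the form needed for local Leray solutions, Lemarié-Rieusset 2016,
proof of Thm. 14.7, p. 515). [cite: Serrin1963, §4] -/
theorem doubling_identity_compact {T δ : ℝ} (hT : 0 < T)
    {Q : ℝ → ℝ → ℝ} {c c' : ℝ → ℝ} {f g : ℝ → ℝ → ℝ}
    (hQi : Integrable (fun p : ℝ × ℝ => Q p.2 p.1)
      ((volume.restrict (Ioo 0 T)).prod (volume.restrict (Ioo 0 T))))
    (hA : ∀ᵐ σ ∂(volume.restrict (Ioo 0 T)), IntegrableOn (f σ) (Ioo 0 T) ∧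
      ∀ᵐ s ∂(volume.restrict (Ioo 0 T)), Q s σ = c σ + ∫ τ in Ioc 0 s, f σ τ)
    (hB : ∀ᵐ s ∂(volume.restrict (Ioo 0 T)), IntegrableOn (g s) (Ioo 0 T) ∧
      ∀ᵐ σ ∂(volume.restrict (Ioo 0 T)), Q s σ = c' s + ∫ τ in Ioc 0 σ, g s τ)
    (hfi : Integrable (fun p : ℝ × ℝ => f p.1 p.2)
      ((volume.restrict (Ioo 0 T)).prod (volume.restrict (Ioo 0 T))))
    (hgi : Integrable (fun p : ℝ × ℝ => g p.2 p.1)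
      ((volume.restrict (Ioo 0 T)).prod (volume.restrict (Ioo 0 T))))
    {χ : ℝ → ℝ} (hχ : ContDiff ℝ 1 χ) (hχs : tsupport χ ⊆ Icc δ (T - δ))
    (φ : ContDiffBump (0 : ℝ)) (hφ : φ.rOut < δ) :
    ∫ p, φ.normed volume (p.2 - p.1) * deriv χ p.2 * Q p.2 p.1
        ∂((volume.restrict (Ioo 0 T)).prod (volume.restrict (Ioo 0 T))) =
      -∫ p, φ.normed volume (p.2 - p.1) * χ p.2 * (f p.1 p.2 + g p.2 p.1)
        ∂((volume.restrict (Ioo 0 T)).prod (volume.restrict (Ioo 0 T))) := by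
  set μI : Measure ℝ := volume.restrict (Ioo 0 T) with hμI
  have hSm : MeasurableSet (Ioo (0 : ℝ) T) := measurableSet_Ioo
  -- the kernel and its bounds
  set ρ : ℝ → ℝ := φ.normed volume with hρ
  have hρ1 : ContDiff ℝ 1 ρ := φ.contDiff_normed
  have hρc : Continuous ρ := φ.continuous_normed
  have hρ'c : Continuous (deriv ρ) := hρ1.continuous_deriv le_rfl
  obtain ⟨C', hC'0, hC'⟩ := exists_abs_deriv_normed_le φ
  obtain ⟨C, hC0, hC⟩ := exists_normed_le φ
  have hρabs : ∀ x, |ρ x| ≤ C := fun x => by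
    rw [abs_of_nonneg (φ.nonneg_normed x)]; exact hC x
  -- the cut-off and its bounds
  have hχK : HasCompactSupport χ := isCompact_Icc.of_isClosed_subset (isClosed_tsupport _) hχs
  have hχc : Continuous χ := hχ.continuous
  have hχ'c : Continuous (deriv χ) := hχ.continuous_deriv le_rfl
  obtain ⟨Cχ, hCχ⟩ := hχc.bounded_above_of_compact_support hχK
  obtain ⟨Cχ', hCχ'⟩ := hχ'c.bounded_above_of_compact_support hχK.deriv
  have hχ0 : ∀ s, s ∉ Icc δ (T - δ) → χ s = 0 := fun s hs =>
    image_eq_zero_of_notMem_tsupport fun h => hs (hχs h)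
  have hχ'0 : ∀ s, s ∉ Icc δ (T - δ) → deriv χ s = 0 := fun s hs => by
    rw [← fderiv_apply_one_eq_deriv, fderiv_of_notMem_tsupport ℝ (fun h => hs (hχs h))]
    rfl
  have hδ : 0 < δ := φ.rOut_pos.trans hφ
  have hχT : χ T = 0 := hχ0 T fun h => by linarith [h.2]
  have hχz : χ 0 = 0 := hχ0 0 fun h => by linarith [h.1]
  -- ### (A) integrate first in `s`: by parts against the primitive, for a.e. `σ`
  have hAi : ∀ᵐ σ ∂μI, ∫ s, (deriv ρ (s - σ) * χ s + ρ (s - σ) * deriv χ s) * Q s σ ∂μI =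
      -∫ s, ρ (s - σ) * χ s * f σ s ∂μI := by
    filter_upwards [hA] with σ hσ
    obtain ⟨hfσ, hrep⟩ := hσ
    have hθ : ContDiff ℝ 1 fun s => ρ (s - σ) * χ s :=
      (hρ1.comp (contDiff_id.sub contDiff_const)).mul hχ
    have hθ' : ∀ s, deriv (fun s => ρ (s - σ) * χ s) s =
        deriv ρ (s - σ) * χ s + ρ (s - σ) * deriv χ s := by
      intro s
      have h1 : DifferentiableAt ℝ (fun s => ρ (s - σ)) s :=
        ((hρ1.differentiable one_ne_zero) _).comp s (differentiableAt_id.sub_const σ)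
      have h2 : DifferentiableAt ℝ χ s := (hχ.differentiable one_ne_zero) s
      rw [deriv_fun_mul h1 h2, deriv_comp_sub_const]
    have hibp := setIntegral_deriv_mul_const_add_setIntegral hT hθ hfσ (c σ)
    simp only [hθ', hχT, hχz, mul_zero, zero_mul, sub_zero, zero_sub] at hibp
    have hlhs : ∫ s, (deriv ρ (s - σ) * χ s + ρ (s - σ) * deriv χ s) * Q s σ ∂μI =
        ∫ s, (deriv ρ (s - σ) * χ s + ρ (s - σ) * deriv χ s) * (c σ + ∫ τ in Ioo 0 s, f σ τ) ∂μI := by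
      refine integral_congr_ae ?_
      filter_upwards [hrep] with s hs
      rw [hs, setIntegral_congr_set (Ioo_ae_eq_Ioc (μ := (volume : Measure ℝ)))]
    rw [hlhs]
    change ∫ s in Ioo 0 T, (deriv ρ (s - σ) * χ s + ρ (s - σ) * deriv χ s) *
      (c σ + ∫ τ in Ioo 0 s, f σ τ) = -∫ s in Ioo 0 T, ρ (s - σ) * χ s * f σ s
    rw [hibp]
  -- ### (B) integrate first in `σ`: by parts for `s ∈ supp χ`, trivially otherwise, for a.e. `s`
  have hQs : ∀ᵐ s ∂μI, Integrable (fun σ => Q s σ) μI := hQi.prod_left_ae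
  have hBi : ∀ᵐ s ∂μI, ∫ σ, (deriv ρ (s - σ) * χ s + ρ (s - σ) * deriv χ s) * Q s σ ∂μI =
      (∫ σ, ρ (s - σ) * χ s * g s σ ∂μI) + ∫ σ, ρ (s - σ) * deriv χ s * Q s σ ∂μI := by
    filter_upwards [hB, hQs] with s hs hQσ
    obtain ⟨hgs, hrep⟩ := hs
    have i1 : Integrable (fun σ => deriv ρ (s - σ) * Q s σ) μI :=
      hQσ.bdd_mul (hρ'c.comp (continuous_const.sub continuous_id)).aestronglyMeasurable
        (Eventually.of_forall fun σ => by rw [Real.norm_eq_abs]; exact hC' _)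
    have i2 : Integrable (fun σ => ρ (s - σ) * Q s σ) μI :=
      hQσ.bdd_mul (hρc.comp (continuous_const.sub continuous_id)).aestronglyMeasurable
        (Eventually.of_forall fun σ => by rw [Real.norm_eq_abs]; exact hρabs _)
    have hsplit : ∫ σ, (deriv ρ (s - σ) * χ s + ρ (s - σ) * deriv χ s) * Q s σ ∂μI =
        χ s * ∫ σ, deriv ρ (s - σ) * Q s σ ∂μI + ∫ σ, ρ (s - σ) * deriv χ s * Q s σ ∂μI := by
      have hR2 : ∫ σ, ρ (s - σ) * deriv χ s * Q s σ ∂μI = deriv χ s * ∫ σ, ρ (s - σ) * Q s σ ∂μI := by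
        rw [← integral_const_mul]
        refine integral_congr_ae (Eventually.of_forall fun σ => ?_)
        simp only
        ring
      rw [hR2, ← integral_const_mul, ← integral_const_mul,
        ← integral_add (i1.const_mul _) (i2.const_mul _)]
      refine integral_congr_ae (Eventually.of_forall fun σ => ?_)
      simp only
      ring
    rw [hsplit]
    congr 1
    by_cases hsK : s ∈ Icc δ (T - δ)
    · have hθ : ContDiff ℝ 1 fun σ => -ρ (s - σ) := (hρ1.comp (contDiff_const.sub contDiff_id)).neg
      have hθ' : ∀ σ, deriv (fun σ => -ρ (s - σ)) σ = deriv ρ (s - σ) := by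
        intro σ
        rw [show (fun σ => -ρ (s - σ)) = -(fun σ => ρ (s - σ)) from rfl, deriv.neg,
          deriv_comp_const_sub ρ s σ, neg_neg]
      have hibp := setIntegral_deriv_mul_const_add_setIntegral hT hθ hgs (c' s)
      simp only [hθ'] at hibp
      have hρT : ρ (s - T) = 0 := by
        refine normed_eq_zero_of_rOut_le_abs φ ?_
        rw [abs_sub_comm, abs_of_nonneg (by linarith [hsK.2])]
        linarith [hsK.2]
      have hρs : ρ (s - 0) = 0 := by
        rw [sub_zero]
        refine normed_eq_zero_of_rOut_le_abs φ ?_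
        rw [abs_of_nonneg (by linarith [hsK.1])]
        linarith [hsK.1]
      rw [hρT, hρs] at hibp
      simp only [neg_zero, zero_mul, sub_zero, zero_sub] at hibp
      have hlhs : ∫ σ, deriv ρ (s - σ) * Q s σ ∂μI =
          ∫ σ, deriv ρ (s - σ) * (c' s + ∫ τ in Ioo 0 σ, g s τ) ∂μI := by
        refine integral_congr_ae ?_
        filter_upwards [hrep] with σ hσ
        rw [hσ, setIntegral_congr_set (Ioo_ae_eq_Ioc (μ := (volume : Measure ℝ)))]
      rw [hlhs]
      change χ s * ∫ σ in Ioo 0 T, deriv ρ (s - σ) * (c' s + ∫ τ in Ioo 0 σ, g s τ) =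
        ∫ σ in Ioo 0 T, ρ (s - σ) * χ s * g s σ
      rw [hibp, ← integral_neg, ← integral_const_mul]
      refine integral_congr_ae (Eventually.of_forall fun σ => ?_)
      simp only
      ring
    · rw [hχ0 s hsK]
      simp
  -- ### the doubled integrand and the bounded-kernel products are integrable
  have hI : Integrable (fun p : ℝ × ℝ =>
      (deriv ρ (p.2 - p.1) * χ p.2 + ρ (p.2 - p.1) * deriv χ p.2) * Q p.2 p.1) (μI.prod μI) := by
    refine hQi.bdd_mul (c := C' * Cχ + C * Cχ') ?_ (Eventually.of_forall fun p => ?_)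
    · exact (((hρ'c.comp (continuous_snd.sub continuous_fst)).mul (hχc.comp continuous_snd)).add
        ((hρc.comp (continuous_snd.sub continuous_fst)).mul (hχ'c.comp continuous_snd))).aestronglyMeasurable
    · refine (norm_add_le _ _).trans (add_le_add ?_ ?_)
      · rw [norm_mul]
        exact mul_le_mul (by rw [Real.norm_eq_abs]; exact hC' _) (hCχ _) (norm_nonneg _) hC'0
      · rw [norm_mul]
        exact mul_le_mul (by rw [Real.norm_eq_abs]; exact hρabs _) (hCχ' _) (norm_nonneg _) hC0
  have hkc : Continuous fun p : ℝ × ℝ => ρ (p.2 - p.1) * χ p.2 :=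
    (hρc.comp (continuous_snd.sub continuous_fst)).mul (hχc.comp continuous_snd)
  have hkb : ∀ p : ℝ × ℝ, ‖ρ (p.2 - p.1) * χ p.2‖ ≤ C * Cχ := fun p => by
    rw [norm_mul]
    exact mul_le_mul (by rw [Real.norm_eq_abs]; exact hρabs _) (hCχ _) (norm_nonneg _) hC0
  have hIf : Integrable (fun p : ℝ × ℝ => ρ (p.2 - p.1) * χ p.2 * f p.1 p.2) (μI.prod μI) :=
    hfi.bdd_mul hkc.aestronglyMeasurable (Eventually.of_forall hkb)
  have hIg : Integrable (fun p : ℝ × ℝ => ρ (p.2 - p.1) * χ p.2 * g p.2 p.1) (μI.prod μI) :=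
    hgi.bdd_mul hkc.aestronglyMeasurable (Eventually.of_forall hkb)
  have hIQ : Integrable (fun p : ℝ × ℝ => ρ (p.2 - p.1) * deriv χ p.2 * Q p.2 p.1) (μI.prod μI) := by
    refine hQi.bdd_mul (c := C * Cχ') ?_ (Eventually.of_forall fun p => ?_)
    · exact ((hρc.comp (continuous_snd.sub continuous_fst)).mul (hχ'c.comp continuous_snd)).aestronglyMeasurable
    · rw [norm_mul]
      exact mul_le_mul (by rw [Real.norm_eq_abs]; exact hρabs _) (hCχ' _) (norm_nonneg _) hC0
  -- ### evaluate the doubled integral both ways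
  have h1 : ∫ p, (deriv ρ (p.2 - p.1) * χ p.2 + ρ (p.2 - p.1) * deriv χ p.2) * Q p.2 p.1 ∂(μI.prod μI) =
      -∫ p, ρ (p.2 - p.1) * χ p.2 * f p.1 p.2 ∂(μI.prod μI) := by
    rw [integral_prod _ hI, integral_prod _ hIf, ← integral_neg]
    exact integral_congr_ae hAi
  have h2 : ∫ p, (deriv ρ (p.2 - p.1) * χ p.2 + ρ (p.2 - p.1) * deriv χ p.2) * Q p.2 p.1 ∂(μI.prod μI) =
      (∫ p, ρ (p.2 - p.1) * χ p.2 * g p.2 p.1 ∂(μI.prod μI)) +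
        ∫ p, ρ (p.2 - p.1) * deriv χ p.2 * Q p.2 p.1 ∂(μI.prod μI) := by
    rw [integral_prod_symm _ hI, integral_prod_symm _ hIg, integral_prod_symm _ hIQ,
      ← integral_add hIg.integral_prod_right hIQ.integral_prod_right]
    exact integral_congr_ae hBi
  have h3 : ∫ p, ρ (p.2 - p.1) * χ p.2 * (f p.1 p.2 + g p.2 p.1) ∂(μI.prod μI) =
      (∫ p, ρ (p.2 - p.1) * χ p.2 * f p.1 p.2 ∂(μI.prod μI)) +
        ∫ p, ρ (p.2 - p.1) * χ p.2 * g p.2 p.1 ∂(μI.prod μI) := by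
    rw [← integral_add hIf hIg]
    refine integral_congr_ae (Eventually.of_forall fun p => ?_)
    simp only
    ring
  rw [h3]
  linarith [h1, h2]

end Literature.Analysis.FunctionSpaces
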